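import Mathlib
import Summits.NavierStokesRegularity.NavierStokesRegularity.Theorems.LandauTailLandauTailBlowupShellError
import Summits.NavierStokesRegularity.NavierStokesRegularity.Theorems.LandauTailLandauTailBlowupCoreRadiusEnergy

/-!
# Crux `LandauTail.LandauTailBlowup` (stmt-NavierStokesRegularity-1944), line `registered`, cycle c7:
  stub `landauTail_momentum_loss_tame` — the momentum law in the tame limit

Helper file on the proof path of the crux item `stmt-NavierStokesRegularity-1944`
(`Summit.NavierStokesRegularity.NavierStokesRegularity.Theses.LandauTail.LandauTailBlowup`), lead c7: the
registered support stub `landauTail_momentum_loss_tame` (L7), composed from the exact local momentum law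
(`landauTail_momentum_law`, p173098) and the integrated shell error (`landauTail_shell_error_integral`).

THEOREM. For a nonzero steady `(−1)`-homogeneous profile `(U, P)` smooth off the origin (Landau axis `a`, force
`β = 2πβ(A)`): along the rescalings `u_λ`, `λ → 0⁺`, of ANY classical unit-viscosity flow on `ℝ³ × (−1,0)` that is
TAME on the shell of radius `ρ` over the window `(s₁, s₂)` (`∫_{s₁}^{s₂}∫_{ρ/2<|y|<ρ}|u_λ − U|² → 0`), the local
momentum `M_λ(t) = ∫⟪u_λ(t), φ_ρ⟫` against any plateau test of radius `ρ` with value `a` loses exactly Landau's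
force: `M_λ(t₁) − M_λ(t₂) → β (t₂ − t₁)` for all `s₁ ≤ t₁ < t₂ ≤ s₂`.

This is STRATEGY-CENSUS §F4 of the crux ("the inner solution of a Landau-tailed singularity is SECULAR: it feeds
momentum to the jet at the constant rate b; no quasi-steady inner solution exists") as a theorem, under an
`L²`-shell hypothesis only (no pointwise convergence, no pressure, no `C¹` control).

PROOF. `M_λ′ = −β + E_λ` with `∫_{s₁}^{s₂}|E_λ| ≤ A₁(d_λ/(2γ) + (γ/2)ρ³|B₁|(s₂−s₁)) + A₂ d_λ` for every `γ > 0`,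
`d_λ` the shell defect; let `λ → 0` then `γ → 0`.
-/

set_option linter.dupNamespace false

noncomputable section

open Filter Set Topology MeasureTheory Metric Function
open scoped ENNReal NNReal InnerProductSpace RealInnerProductSpace Laplacian ContDiff
open Literature.Analysis.FluidPDE

namespace Summit.NavierStokesRegularity.NavierStokesRegularity.Theorems

/-- **L7 — the momentum law in the tame limit** (registered support stub of crux stmt-NavierStokesRegularity-1944,
lead c7): along the rescalings `u_λ` of a classical flow tame on the shell of radius `ρ` over `(s₁, s₂)`, the local
momentum against the plateau test loses exactly Landau's force, `M_λ(t₁) − M_λ(t₂) → β (t₂ − t₁)`. [folklore] -/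
theorem landauTail_momentum_loss_tame : ∀ (U : EuclideanSpace ℝ (Fin 3) → EuclideanSpace ℝ (Fin 3)) (P : EuclideanSpace ℝ (Fin 3) → ℝ), (ContDiffOn ℝ (⊤ : ℕ∞) U {0}ᶜ ∧ ContDiffOn ℝ (⊤ : ℕ∞) P {0}ᶜ ∧ (∀ x : EuclideanSpace ℝ (Fin 3), x ≠ 0 → Literature.Analysis.FluidPDE.convect U U x + gradient P x = (1 : ℝ) • Laplacian.laplacian U x) ∧ (∀ x : EuclideanSpace ℝ (Fin 3), x ≠ 0 → Literature.Analysis.FluidPDE.VectorCalculus.divergence U x = 0) ∧ (∀ c : ℝ, 0 < c → ∀ x : EuclideanSpace ℝ (Fin 3), U (c • x) = c⁻¹ • U x) ∧ (∃ x : EuclideanSpace ℝ (Fin 3), U x ≠ 0)) → ∃ a : EuclideanSpace ℝ (Fin 3), ‖a‖ = 1 ∧ ∃ β : ℝ, 0 < β ∧ ∀ (u : ℝ → EuclideanSpace ℝ (Fin 3) → EuclideanSpace ℝ (Fin 3)) (p : ℝ → EuclideanSpace ℝ (Fin 3) → ℝ), Literature.Analysis.FluidPDE.IsClassicalNSSolutionOn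 (Set.Ioo (-1) 0) 1 0 u p → ∀ (ρ K : ℝ) (φ : EuclideanSpace ℝ (Fin 3) → EuclideanSpace ℝ (Fin 3)), 0 < ρ → ρ ≤ 1 → 0 ≤ K → ContDiff ℝ (⊤ : ℕ∞) φ → tsupport φ ⊆ Metric.ball (0 : EuclideanSpace ℝ (Fin 3)) ρ → (∀ x, Literature.Analysis.FluidPDE.VectorCalculus.divergence φ x = 0) → (∀ x ∈ Metric.closedBall (0 : EuclideanSpace ℝ (Fin 3)) (ρ / 2), φ x = a) → (∀ x ∈ Metric.closedBall (0 : EuclideanSpace ℝ (Fin 3)) (ρ / 2), fderiv ℝ φ x = 0) → (∀ x ∈ Metric.closedBall (0 : EuclideanSpace ℝ (Fin 3)) (ρ / 2), Laplacian.laplacian φ x = 0) → (∀ x, ‖fderiv ℝ φ x‖ ≤ K / ρ) → (∀ x, ‖Laplacian.laplacian φ x‖ ≤ K / ρ ^ 2) → ∀ s₁ s₂ : ℝ, -1 < s₁ → s₁ < s₂ → s₂ < 0 → Filter.Tendsto (fun lam : ℝ => ∫⁻ z in Set.Ioo s₁ s₂ ×ˢ (Metric.ball (0 : EuclideanSpace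 ℝ (Fin 3)) ρ \ Metric.closedBall (0 : EuclideanSpace ℝ (Fin 3)) (ρ / 2)), ‖Literature.Analysis.FluidPDE.nsRescale lam u z.1 z.2 - U z.2‖ₑ ^ 2) (nhdsWithin 0 (Set.Ioi 0)) (nhds 0) → ∀ t₁ t₂ : ℝ, s₁ ≤ t₁ → t₁ < t₂ → t₂ ≤ s₂ → Filter.Tendsto (fun lam : ℝ => (∫ x, inner ℝ (Literature.Analysis.FluidPDE.nsRescale lam u t₁ x) (φ x)) - ∫ x, inner ℝ (Literature.Analysis.FluidPDE.nsRescale lam u t₂ x) (φ x)) (nhdsWithin 0 (Set.Ioi 0)) (nhds (β * (t₂ - t₁))) := by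
  intro U P hprof
  have hUc : ContinuousOn U {0}ᶜ := hprof.1.continuousOn
  obtain ⟨a, ha, β, hβ, L, hL, hlaw⟩ := landauTail_momentum_law U P hprof
  refine ⟨a, ha, β, hβ, ?_⟩
  intro u p hcl ρ K φ hρ _hρ1 hK0 hφs hφsupp hφdiv hφa hφD0 hφΔ0 hφD hφΔ s₁ s₂ hs₁ hs₁₂ hs₂ htame t₁ t₂ ht₁ ht₁₂ ht₂
  set V₁ : ℝ := (volume (ball (0 : EuclideanSpace ℝ (Fin 3)) 1)).toReal with hV₁_def
  have hV₁0 : 0 ≤ V₁ := ENNReal.toReal_nonneg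
  set Δs : ℝ := s₂ - s₁ with hΔs_def
  have hΔs : 0 < Δs := by rw [hΔs_def]; linarith
  set A₁ : ℝ := K / ρ ^ 2 * (1 + 4 * L) with hA₁_def
  set A₂ : ℝ := K / ρ with hA₂_def
  have hA₁ : 0 ≤ A₁ := by positivity
  have hA₂ : 0 ≤ A₂ := by positivity
  have hIcc : Icc s₁ s₂ ⊆ Ioo (-1 : ℝ) 0 := fun t ht => ⟨hs₁.trans_le ht.1, ht.2.trans_lt hs₂⟩
  rw [Metric.tendsto_nhds]
  intro δ hδ
  -- the Young parameter `γ` and the defect threshold `dmax`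
  set γ : ℝ := δ / (2 * (A₁ * (ρ ^ 3 * V₁) * Δs + 1)) with hγ_def
  have hγ : 0 < γ := by positivity
  set dmax : ℝ := δ / (2 * (A₁ * (1 / (2 * γ)) + A₂ + 1)) with hdmax_def
  have hdmax : 0 < dmax := by positivity
  have hBerr : A₁ * (1 / (2 * γ) * dmax + γ / 2 * (ρ ^ 3 * V₁) * Δs) + A₂ * dmax < δ := by
    have e1 : A₁ * (γ / 2 * (ρ ^ 3 * V₁) * Δs) = (A₁ * (ρ ^ 3 * V₁) * Δs) * γ / 2 := by ring
    have h1 : (A₁ * (ρ ^ 3 * V₁) * Δs) * γ / 2 ≤ δ / 4 := by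
      rw [hγ_def]
      have hX : 0 ≤ A₁ * (ρ ^ 3 * V₁) * Δs := by positivity
      rw [div_le_div_iff₀ two_pos (by norm_num : (0 : ℝ) < 4)]
      have : A₁ * (ρ ^ 3 * V₁) * Δs * (δ / (2 * (A₁ * (ρ ^ 3 * V₁) * Δs + 1))) ≤ δ / 2 := by
        rw [mul_div_assoc', div_le_div_iff₀ (by positivity) two_pos]
        nlinarith [hδ.le]
      linarith
    have h2 : (A₁ * (1 / (2 * γ)) + A₂) * dmax ≤ δ / 2 := by
      rw [hdmax_def, mul_div_assoc', div_le_div_iff₀ (by positivity) two_pos]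
      have hY : 0 ≤ A₁ * (1 / (2 * γ)) + A₂ := by positivity
      nlinarith [hδ.le]
    have e2 : A₁ * (1 / (2 * γ) * dmax + γ / 2 * (ρ ^ 3 * V₁) * Δs) + A₂ * dmax =
        (A₁ * (1 / (2 * γ)) + A₂) * dmax + (A₁ * (ρ ^ 3 * V₁) * Δs) * γ / 2 := by ring
    rw [e2]
    linarith
  -- eventually the shell defect is below `dmax` and `λ ≤ 1`
  have hpos : (0 : ℝ≥0∞) < ENNReal.ofReal dmax := ENNReal.ofReal_pos.2 hdmax
  have h1 := (htame.eventually (gt_mem_nhds hpos))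
  have h2 : ∀ᶠ lam in 𝓝[>] (0 : ℝ), lam ∈ Ioc (0 : ℝ) 1 := Ioc_mem_nhdsGT zero_lt_one
  filter_upwards [h1, h2] with lam hclose hlam
  have hv := landauTail_coreRadius_nsRescale_classical hcl hlam.1 hlam.2
  obtain ⟨hder, hcont, herr⟩ := hlaw (nsRescale lam u) (nsRescalePressure lam p) hv ρ K φ hρ hK0 hφs hφsupp hφdiv hφa
    hφD0 hφΔ0 hφD hφΔ
  set M : ℝ → ℝ := fun s => ∫ x, ⟪nsRescale lam u s x, φ x⟫ with hM_def
  set Fl : ℝ → ℝ := fun t => ∫ x, (⟪nsRescale lam u t x, convect (nsRescale lam u t) φ x⟫ +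
    ⟪nsRescale lam u t x, Δ φ x⟫) with hFl_def
  -- the integrated error over the whole window
  have herrI := landauTail_shell_error_integral (F := Fl) (γ := γ) (d := dmax) hUc hv hρ hA₁ hA₂ hcont herr hs₁ hs₁₂ hs₂
    hγ hdmax.le hclose.le
  rw [← hV₁_def, ← hΔs_def] at herrI
  have hB : ∫ t in Ioo s₁ s₂, |Fl t + β| < δ := herrI.trans_lt hBerr
  -- restrict to the sub-window `[t₁, t₂]` and read off the momentum loss
  have hFlc : ContinuousOn (fun t => |Fl t + β|) (Icc s₁ s₂) := ((hcont.mono hIcc).add continuousOn_const).abs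
  have hint : IntegrableOn (fun t => |Fl t + β|) (Ioo s₁ s₂) volume :=
    (hFlc.integrableOn_compact isCompact_Icc).mono_set Ioo_subset_Icc_self
  have hsub : Ioo t₁ t₂ ⊆ Ioo s₁ s₂ := Ioo_subset_Ioo ht₁ ht₂
  have hBsub : ∫ t in Ioo t₁ t₂, |Fl t + β| ≤ ∫ t in Ioo s₁ s₂, |Fl t + β| :=
    setIntegral_mono_set hint (Eventually.of_forall fun t => abs_nonneg _) (Eventually.of_forall hsub)
  have hIcc' : Icc t₁ t₂ ⊆ Ioo (-1 : ℝ) 0 := (Icc_subset_Icc ht₁ ht₂).trans hIcc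
  have hline := landauTail_shellEnstrophy_line (M := M) (F := Fl) (β := β) ht₁₂ (fun t ht => hder t (hIcc' ht))
    (hcont.mono hIcc') hBsub (right_mem_Icc.2 ht₁₂.le)
  rw [Real.dist_eq]
  calc |(M t₁ - M t₂) - β * (t₂ - t₁)| = |M t₂ - (M t₁ - β * (t₂ - t₁))| := by
        rw [abs_sub_comm]; ring_nf
    _ ≤ ∫ t in Ioo s₁ s₂, |Fl t + β| := hline
    _ < δ := hB

end Summit.NavierStokesRegularity.NavierStokesRegularity.Theorems

end
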